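import Summits.CriticalPhenomena.PercolationContinuityZ3.Theses.PercNearOneGluing
import Literature.Probability.Percolation.PercolationEvents
import Literature.Probability.LatticeModels.ProdBernoulliIndependence
import HarnessLib.Audit

/-! TTRL-lite variant V2370 of stmt-CriticalPhenomena-4574 -/

namespace Summit.CriticalPhenomena.PercolationContinuityZ3.Theorems

open MeasureTheory Set Literature.Probability.LatticeModels Literature.Probability.Percolation
open scoped Classical BigOperators

/-- TTRL-lite variant V2370 (`strengthen_concl`: the final `≤` replaced by `<`) of the shortening
step of `stmt-CriticalPhenomena-4574` is **false**.  Witness: `n = 2`, all weights `w ≡ 0`,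
`v = b = 0`, `x = a₀ = 1`, `A = {1}`.  After gluing, the edge `s(0, 1)` has weight `1` and is
almost surely open, so `P(⋃ a ∈ A, v ↔ a) = P(a₀ ↔ b) = 1 = P(v ↔ b)` and the strict
inequality `1 · 1 < 1` fails.  The induction hypothesis in the premises holds for `w ≡ 0`
because the only admissible `w'` is `0`, whose law is `dirac ∅` (every edge closed), under
which `P(o' ↔ a) = [o' = a]`. -/
theorem stub_shorteningStep_var2370_false :
    ¬ (∀ (n : ℕ) (w : Sym2 (Fin n) → unitInterval) (A : Finset (Fin n)) (b v x a₀ : Fin n),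
      v ∉ A → v ≠ x → w s(v, x) = 0 → a₀ ∈ A →
      (∀ a ∈ A, (prodBernoulli w).real (openConn a₀ b) ≤ (prodBernoulli w).real (openConn a b)) →
      (∀ w' : Sym2 (Fin n) → unitInterval, (∀ e, w e = 0 → w' e = 0) →
        ∀ (A' : Finset (Fin n)) (o' b' : Fin n) (t : ℝ),
          (∀ a ∈ A', t ≤ (prodBernoulli w').real (openConn a b')) →
          (prodBernoulli w').real (⋃ a ∈ A', openConn o' a) * t ≤
            (prodBernoulli w').real (openConn o' b')) →
      (prodBernoulli (Function.update w s(v, x) 1)).real (⋃ a ∈ A, openConn v a) *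
          (prodBernoulli (Function.update w s(v, x) 1)).real (openConn a₀ b) <
        (prodBernoulli (Function.update w s(v, x) 1)).real (openConn v b)) := by
  intro h
  -- the all-zero weight has law `dirac ∅`
  have hzero : prodBernoulli (fun _ : Sym2 (Fin 2) => (0 : unitInterval)) = Measure.dirac ∅ := by
    rw [prodBernoulli_const, ProbabilityTheory.setBernoulli_zero]
  have hreal : ∀ S : Set (BondConfig (Fin 2)),
      (prodBernoulli (fun _ : Sym2 (Fin 2) => (0 : unitInterval))).real S =
        if (∅ : BondConfig (Fin 2)) ∈ S then 1 else 0 := by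
    intro S
    rw [hzero, measureReal_def, Measure.dirac_apply]
    by_cases hS : (∅ : BondConfig (Fin 2)) ∈ S <;> simp [hS]
  -- in the empty configuration, `o ↔ a` iff `o = a`
  have hconn : ∀ o a : Fin 2, (∅ : BondConfig (Fin 2)) ∈ openConn o a ↔ o = a := by
    intro o a
    change (openGraph (∅ : BondConfig (Fin 2))).Reachable o a ↔ o = a
    have hbot : openGraph (∅ : BondConfig (Fin 2)) = ⊥ := SimpleGraph.fromEdgeSet_empty
    rw [hbot, SimpleGraph.reachable_bot]
  -- the induction hypothesis holds for `w ≡ 0`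
  have hIH : ∀ w' : Sym2 (Fin 2) → unitInterval,
      (∀ e, (fun _ : Sym2 (Fin 2) => (0 : unitInterval)) e = 0 → w' e = 0) →
      ∀ (A' : Finset (Fin 2)) (o' b' : Fin 2) (t : ℝ),
        (∀ a ∈ A', t ≤ (prodBernoulli w').real (openConn a b')) →
        (prodBernoulli w').real (⋃ a ∈ A', openConn o' a) * t ≤
          (prodBernoulli w').real (openConn o' b') := by
    intro w' hw' A' o' b' t ht
    obtain rfl : w' = fun _ => 0 := funext fun e => hw' e rfl
    by_cases ho : o' ∈ A'
    · have hmem : (∅ : BondConfig (Fin 2)) ∈ ⋃ a ∈ A', openConn o' a :=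
        Set.mem_iUnion₂.2 ⟨o', ho, (hconn o' o').2 rfl⟩
      rw [hreal (⋃ a ∈ A', openConn o' a), if_pos hmem, one_mul]
      exact ht o' ho
    · have hnmem : (∅ : BondConfig (Fin 2)) ∉ ⋃ a ∈ A', openConn o' a := by
        intro hmem
        obtain ⟨a, ha, hoa⟩ := Set.mem_iUnion₂.1 hmem
        exact ho (by rw [(hconn o' a).1 hoa]; exact ha)
      rw [hreal (⋃ a ∈ A', openConn o' a), if_neg hnmem, zero_mul]
      exact measureReal_nonneg
  -- specialise to the witness
  have key := h 2 (fun _ => 0) {1} 0 0 1 1 (by decide) (by decide) rfl (by simp)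
    (fun a ha => by rw [Finset.mem_singleton.1 ha]) hIH
  -- the glued edge `s(0, 1)` is almost surely open
  have hedge : (prodBernoulli (Function.update (fun _ : Sym2 (Fin 2) => (0 : unitInterval))
      s((0 : Fin 2), (1 : Fin 2)) 1)).real {ω | s((0 : Fin 2), (1 : Fin 2)) ∈ ω} = 1 := by
    rw [prodBernoulli_real_setOf_mem]; simp
  have h01 : (1 : ℝ) ≤ (prodBernoulli (Function.update (fun _ : Sym2 (Fin 2) => (0 : unitInterval))
      s((0 : Fin 2), (1 : Fin 2)) 1)).real (⋃ a ∈ ({1} : Finset (Fin 2)), openConn (0 : Fin 2) a) := by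
    rw [← hedge]
    refine measureReal_mono ?_ (measure_ne_top _ _)
    intro ω hω
    refine Set.mem_iUnion₂.2 ⟨1, Finset.mem_singleton_self _, ?_⟩
    exact SimpleGraph.Adj.reachable ((openGraph_adj ω 0 1).2 ⟨hω, by decide⟩)
  have h10 : (1 : ℝ) ≤ (prodBernoulli (Function.update (fun _ : Sym2 (Fin 2) => (0 : unitInterval))
      s((0 : Fin 2), (1 : Fin 2)) 1)).real (openConn (1 : Fin 2) (0 : Fin 2)) := by
    rw [← hedge]
    refine measureReal_mono ?_ (measure_ne_top _ _)
    intro ω hω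
    exact (SimpleGraph.Adj.reachable ((openGraph_adj ω 0 1).2 ⟨hω, by decide⟩)).symm
  have h00 : (prodBernoulli (Function.update (fun _ : Sym2 (Fin 2) => (0 : unitInterval))
      s((0 : Fin 2), (1 : Fin 2)) 1)).real (openConn (0 : Fin 2) (0 : Fin 2)) ≤ 1 :=
    measureReal_le_one
  have hprod := one_le_mul_of_one_le_of_one_le h01 h10
  exact lt_irrefl (1 : ℝ) (lt_of_le_of_lt hprod (lt_of_lt_of_le key h00))

end Summit.CriticalPhenomena.PercolationContinuityZ3.Theorems
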